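import Summits.QuantumFields.BalabanUV.T4Continuum.Support.NE7FlatAverageCurlCommutation
import Summits.QuantumFields.BalabanUV.T4Continuum.Support.NE3CovariantLineSumGauge
import Summits.QuantumFields.BalabanUV.T4Continuum.Support.AveragingDeficitHSInner
import Summits.QuantumFields.BalabanUV.T4Continuum.Support.AveragingDeficitBlockDensity
import Summits.QuantumFields.BalabanUV.T4Continuum.Support.MinimalActionLevels
import HarnessLib

/-!
# NE7CoarseCurlEnergyFlatSharp — THE SHARP, VOLUME-INDEPENDENT COMPARISON OF THE COARSE AND FINE MAXWELL ENERGIES UNDER THE LINEARISED AVERAGE AT THE FLAT BACKGROUND: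
# `Σ_{P} ‖curl_1 (Q′X)(P)‖²_{HS∕n} ≤ L^{4−d} · Σ_{p} ‖curl_1 X (p)‖²_{HS∕n}`, ONE STEP AND ALL LEVELS (ROAD-G115 §11 (x)+(xi) of the lineage `b2b-balaban-t4-ne7-p1`, gen 116)

`T := D(coord_id L M 1)(0)` (one linearised averaging step at the flat configuration; `levelQ' L N j 1` is its `(j+1)`-fold iterate followed by `skewPR`, ✓
`NE7FlatAverageCurlCommutation`).  WHAT ([folklore]; 0 def, 0 sorry):
* `nhsNormSq_blockAvg_le` — Jensen ∕ Cauchy–Schwarz for the block average of `L × L`-square sums: `nhsNormSq(Σ_r L^{−d}•Σ_{i,j<L} A r i j) ≤ (L²∕L^d)·Σ_{r,i,j} nhsNormSq(A r i j)`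
  (✓ `NE3CovariantLineSumCore.nhsNormSq_sum_le_card_mul`, ✓ `AveragingDeficitHSInner.nhsNormSq_smul`).
* **`coarse_curl_energy_le_sharp`** (ONE STEP, every `ψ ∈ TDir (L·M)`, no skewness needed):
  `Σ_{P ∈ perWin M} nhsNormSq(curl_1 (Tψ)̃ P) ≤ (L⁴∕L^d) · Σ_{p ∈ perWin (L·M)} nhsNormSq(curl_1 ψ̃ p)`
  — the commutation ✓ `curlAt_chartDir_fderiv_coord_flatCfg` (Bałaban's (48)), Jensen, and the periodic covering identity ✓ `T4AveragingDeficitNonAbelian.sum_stencil_periodBox`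
  (every fine plaquette is counted `L²` times).  In `d = 4` the constant is ONE (attained on constant-curl fields).
* **`coarse_curl_energy_levelQ'_flat_le`** (ALL LEVELS, skew `X ∈ skewSub (L·tower L N j)`):
  `Σ_{P ∈ perWin N} nhsNormSq(curl_1 (levelQ' L N j 1 X)̃ P) ≤ (L⁴∕L^d)^{j+1} · Σ_{p ∈ perWin (L·tower L N j)} nhsNormSq(curl_1 X̃ p)` — induction along ✓ `levelQ'_succ_flatCfg`.
This SUPERSEDES the volume-dependent constant `1 + wallConst 4 L·√((LN)⁴·4·#planes)·4·card n` of ✓ `NE7CoarseCurlEnergyFlatQuant.coarse_curl_energy_le_quant` (gen 115, one step) by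
`L^{4−d}` (= 1 in `d = 4`), uniformly in the volume `N`, the colour number `n` and the level `j`.  Consumer: `NE7EffectiveFormCoarseCurlAllLevels` (⟨v, Δ_{j+1} v⟩ ≥ Σ_P ‖curl_1 v‖²).
HONEST FRAMING: flat background; linearised (second-order) statement; nothing of Bałaban's asserted (context only: [Balaban1985Averaging] (48) p. 25; no printed propagator bound is
claimed); NOT NE7 as a spine node, NOT NE3; spine 0∕9; NOT infinite volume, NOT mass gap, NOT BetaPertH, NOT Clay.
-/

set_option autoImplicit false

open scoped BigOperators Matrix Matrix.Norms.L2Operator Topology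
open NormedSpace Finset

namespace Summit.QuantumFields.BalabanUV.T4Continuum.NE7CoarseCurlEnergyFlatSharp

open Literature.MathematicalPhysics.QuantumFieldTheory.Balaban1983to89
open B7Prop1Explicit B7Prop2Explicit
open T4AveragingDeficitWall (curl curlAt)
open T4AveragingDeficitWallBoundary (periodBox blockSites_periodBox)
open T4AveragingDeficitNonAbelian (sum_stencil_periodBox)
open AveragingDeficitPeriodicCounting (IsPeriodicDir)
open AveragingDeficitTorusChart (TDir chartDir isPeriodicDir_chartDir)
open AveragingDeficitChartCalculus (coord)
open AveragingDeficitTwoLevelPrep (skewSub)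
open AveragingDeficitMultiLevelPrep (tower levelQ' tower_ne_zero)
open AveragingDeficitHSInner (nhsNormSq_smul)
open AveragingDeficitBlockDensity (card_offsets_real)
open NE3CovariantLineSumCore (nhsNormSq_sum_le_card_mul)
open MinimalActionLevels (perWin)
open MinimalActionWitness (flatCfg)
open MatrixNorms (nhsNormSq nhsNormSq_nonneg)
open NE7FlatAverageCurlCommutation (curlAt_chartDir_fderiv_coord_flatCfg curlAt_flatCfg_add_period fderiv_coord_flatCfg_mem_skewSub
  coe_levelQ'_zero_flatCfg levelQ'_succ_flatCfg)

noncomputable section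

variable {d : ℕ} {n : Type*} [Fintype n] [DecidableEq n]

/-! ## §1 Jensen for the block average of square sums -/

omit [DecidableEq n] in
/-- **Jensen ∕ Cauchy–Schwarz for the block average of `L × L`-square sums** in the normalised Hilbert–Schmidt currency:
`nhsNormSq (Σ_{r ∈ [0,L)^d} L^{−d} • Σ_{i<L} Σ_{j<L} A r i j) ≤ (L² ∕ L^d) · Σ_r Σ_i Σ_j nhsNormSq (A r i j)` (`L^{d+2}` terms of weight `L^{−d}`). [folklore] -/
theorem nhsNormSq_blockAvg_le [Nonempty n] (L : ℕ) [NeZero L] (A : (Fin d → Fin L) → ℕ → ℕ → Matrix n n ℂ) :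
    nhsNormSq (∑ r : Fin d → Fin L, (((L : ℝ) ^ d)⁻¹ : ℝ) • ∑ i ∈ Finset.range L, ∑ j ∈ Finset.range L, A r i j)
      ≤ (L : ℝ) ^ 2 / (L : ℝ) ^ d * ∑ r : Fin d → Fin L, ∑ i ∈ Finset.range L, ∑ j ∈ Finset.range L, nhsNormSq (A r i j) := by
  have hL0 : (L : ℝ) ≠ 0 := by exact_mod_cast (NeZero.ne L)
  rw [← Finset.smul_sum, nhsNormSq_smul]
  set S : ℝ := ∑ r : Fin d → Fin L, ∑ i ∈ Finset.range L, ∑ j ∈ Finset.range L, nhsNormSq (A r i j) with hS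
  have h3 : ∀ (r : Fin d → Fin L) (i : ℕ), nhsNormSq (∑ j ∈ Finset.range L, A r i j) ≤ (L : ℝ) * ∑ j ∈ Finset.range L, nhsNormSq (A r i j) := by
    intro r i
    have h := nhsNormSq_sum_le_card_mul (Finset.range L) (fun j => A r i j)
    rwa [Finset.card_range] at h
  have h2 : ∀ r : Fin d → Fin L, nhsNormSq (∑ i ∈ Finset.range L, ∑ j ∈ Finset.range L, A r i j)
      ≤ (L : ℝ) * ((L : ℝ) * ∑ i ∈ Finset.range L, ∑ j ∈ Finset.range L, nhsNormSq (A r i j)) := by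
    intro r
    have h := nhsNormSq_sum_le_card_mul (Finset.range L) (fun i => ∑ j ∈ Finset.range L, A r i j)
    rw [Finset.card_range] at h
    refine h.trans (mul_le_mul_of_nonneg_left ?_ (Nat.cast_nonneg L))
    rw [Finset.mul_sum]
    exact Finset.sum_le_sum fun i _ => h3 r i
  have h1 : nhsNormSq (∑ r : Fin d → Fin L, ∑ i ∈ Finset.range L, ∑ j ∈ Finset.range L, A r i j) ≤ (L : ℝ) ^ d * ((L : ℝ) * ((L : ℝ) * S)) := by
    have h := nhsNormSq_sum_le_card_mul (Finset.univ : Finset (Fin d → Fin L)) (fun r => ∑ i ∈ Finset.range L, ∑ j ∈ Finset.range L, A r i j)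
    rw [card_offsets_real] at h
    refine h.trans (mul_le_mul_of_nonneg_left ?_ (by positivity))
    calc ∑ r : Fin d → Fin L, nhsNormSq (∑ i ∈ Finset.range L, ∑ j ∈ Finset.range L, A r i j)
        ≤ ∑ r : Fin d → Fin L, (L : ℝ) * ((L : ℝ) * ∑ i ∈ Finset.range L, ∑ j ∈ Finset.range L, nhsNormSq (A r i j)) :=
          Finset.sum_le_sum fun r _ => h2 r
      _ = (L : ℝ) * ((L : ℝ) * S) := by simp only [hS, Finset.mul_sum]
  calc ((((L : ℝ) ^ d)⁻¹ : ℝ)) ^ 2 * nhsNormSq (∑ r : Fin d → Fin L, ∑ i ∈ Finset.range L, ∑ j ∈ Finset.range L, A r i j)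
      ≤ ((((L : ℝ) ^ d)⁻¹ : ℝ)) ^ 2 * ((L : ℝ) ^ d * ((L : ℝ) * ((L : ℝ) * S))) := mul_le_mul_of_nonneg_left h1 (by positivity)
    _ = (L : ℝ) ^ 2 / (L : ℝ) ^ d * S := by field_simp

/-! ## §2 One step: the coarse Maxwell energy of `Tψ` is at most `L^{4−d}` times the fine Maxwell energy of `ψ` -/

/-- **ONE LINEARISED AVERAGING STEP AT THE FLAT BACKGROUND DOES NOT INCREASE THE MAXWELL ENERGY BEYOND THE FACTOR `L^{4−d}`** (sharp; `= 1` in `d = 4`; volume- and colour-independent):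
for every torus field `ψ ∈ TDir (L·M)`,
`Σ_{P ∈ perWin M} nhsNormSq (curl_1 (Tψ)̃ P) ≤ (L⁴ ∕ L^d) · Σ_{p ∈ perWin (L·M)} nhsNormSq (curl_1 ψ̃ p)`, `T = D(coord_id L M 1)(0)`, `̃ = chartDir id`. [folklore] -/
theorem coarse_curl_energy_le_sharp [Nonempty n] {L M : ℕ} [NeZero L] [NeZero M] [NeZero (L * M)] (ψ : TDir d n (L * M)) :
    ∑ P ∈ perWin d M, nhsNormSq (curl (flatCfg : Site d → Fin d → (Matrix n n ℂ)ˣ)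
        (chartDir (ContinuousLinearMap.id ℝ (Matrix n n ℂ)) M
          ((fderiv ℝ (coord (ContinuousLinearMap.id ℝ (Matrix n n ℂ)) L M (flatCfg : Site d → Fin d → (Matrix n n ℂ)ˣ)) 0) ψ)) P)
      ≤ (L : ℝ) ^ 4 / (L : ℝ) ^ d * ∑ p ∈ perWin d (L * M), nhsNormSq (curl (flatCfg : Site d → Fin d → (Matrix n n ℂ)ˣ)
        (chartDir (ContinuousLinearMap.id ℝ (Matrix n n ℂ)) (L * M) ψ) p) := by
  classical
  have hL : 1 ≤ L := Nat.one_le_iff_ne_zero.mpr (NeZero.ne L)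
  have hM : 1 ≤ M := Nat.one_le_iff_ne_zero.mpr (NeZero.ne M)
  have hL0 : (L : ℝ) ≠ 0 := by exact_mod_cast (NeZero.ne L)
  set Tψ : TDir d n M :=
    (fderiv ℝ (coord (ContinuousLinearMap.id ℝ (Matrix n n ℂ)) L M (flatCfg : Site d → Fin d → (Matrix n n ℂ)ˣ)) 0) ψ with hTψ
  set ψt : Site d → Fin d → Matrix n n ℂ := chartDir (ContinuousLinearMap.id ℝ (Matrix n n ℂ)) (L * M) ψ with hψt
  have hψP : IsPeriodicDir ψt ((L * M : ℕ) : ℤ) := isPeriodicDir_chartDir _ _ ψ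
  -- pointwise Jensen after the commutation identity
  have hpt : ∀ (z : Site d) (π : T4AveragingDeficitWall.Plane d),
      nhsNormSq (curl (flatCfg : Site d → Fin d → (Matrix n n ℂ)ˣ) (chartDir (ContinuousLinearMap.id ℝ (Matrix n n ℂ)) M Tψ) (z, π))
        ≤ (L : ℝ) ^ 2 / (L : ℝ) ^ d * ∑ r : Fin d → Fin L, ∑ i ∈ Finset.range L, ∑ j ∈ Finset.range L,
            nhsNormSq (curlAt (flatCfg : Site d → Fin d → (Matrix n n ℂ)ˣ) ψt ((L : ℤ) • z + boxVec L r + (i : ℤ) • e π.1.1 + (j : ℤ) • e π.1.2) π.1.1 π.1.2) := by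
    intro z π
    rw [show curl (flatCfg : Site d → Fin d → (Matrix n n ℂ)ˣ) (chartDir (ContinuousLinearMap.id ℝ (Matrix n n ℂ)) M Tψ) (z, π)
        = curlAt (flatCfg : Site d → Fin d → (Matrix n n ℂ)ˣ) (chartDir (ContinuousLinearMap.id ℝ (Matrix n n ℂ)) M Tψ) z π.1.1 π.1.2 from rfl,
      hTψ, curlAt_chartDir_fderiv_coord_flatCfg]
    exact nhsNormSq_blockAvg_le L _
  -- sum over the coarse period window
  rw [perWin, Finset.sum_product, perWin, Finset.sum_product]
  calc ∑ z ∈ periodBox M, ∑ π : T4AveragingDeficitWall.Plane d,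
          nhsNormSq (curl (flatCfg : Site d → Fin d → (Matrix n n ℂ)ˣ) (chartDir (ContinuousLinearMap.id ℝ (Matrix n n ℂ)) M Tψ) (z, π))
      ≤ ∑ z ∈ periodBox M, ∑ π : T4AveragingDeficitWall.Plane d, ((L : ℝ) ^ 2 / (L : ℝ) ^ d *
          ∑ r : Fin d → Fin L, ∑ i ∈ Finset.range L, ∑ j ∈ Finset.range L,
            nhsNormSq (curlAt (flatCfg : Site d → Fin d → (Matrix n n ℂ)ˣ) ψt ((L : ℤ) • z + boxVec L r + (i : ℤ) • e π.1.1 + (j : ℤ) • e π.1.2) π.1.1 π.1.2)) :=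
        Finset.sum_le_sum fun z _ => Finset.sum_le_sum fun π _ => hpt z π
    _ = (L : ℝ) ^ 2 / (L : ℝ) ^ d * ∑ π : T4AveragingDeficitWall.Plane d, ∑ z ∈ periodBox M,
          ∑ r : Fin d → Fin L, ∑ i ∈ Finset.range L, ∑ j ∈ Finset.range L,
            nhsNormSq (curlAt (flatCfg : Site d → Fin d → (Matrix n n ℂ)ˣ) ψt ((L : ℤ) • z + boxVec L r + (i : ℤ) • e π.1.1 + (j : ℤ) • e π.1.2) π.1.1 π.1.2) := by
        rw [Finset.sum_comm, Finset.mul_sum]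
        refine Finset.sum_congr rfl fun π _ => ?_
        rw [Finset.mul_sum]
    _ = (L : ℝ) ^ 2 / (L : ℝ) ^ d * ∑ π : T4AveragingDeficitWall.Plane d, ((L : ℝ) ^ 2 * ∑ x ∈ periodBox (L * M),
          nhsNormSq (curlAt (flatCfg : Site d → Fin d → (Matrix n n ℂ)ˣ) ψt x π.1.1 π.1.2)) := by
        congr 1
        refine Finset.sum_congr rfl fun π _ => ?_
        rw [sum_stencil_periodBox L M hL hM (g := fun x => nhsNormSq (curlAt (flatCfg : Site d → Fin d → (Matrix n n ℂ)ˣ) ψt x π.1.1 π.1.2))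
          (fun x κ => by simp only [curlAt_flatCfg_add_period hψP]) π.1.1 π.1.2, blockSites_periodBox L M hL]
    _ = (L : ℝ) ^ 4 / (L : ℝ) ^ d * ∑ x ∈ periodBox (L * M), ∑ π : T4AveragingDeficitWall.Plane d,
          nhsNormSq (curl (flatCfg : Site d → Fin d → (Matrix n n ℂ)ˣ) ψt (x, π)) := by
        rw [← Finset.mul_sum, Finset.sum_comm, ← mul_assoc]
        congr 1
        ring

/-! ## §3 All levels: the `(j+1)`-fold linearised average -/

/-- **ALL LEVELS**: for every `j` and every skew `X ∈ skewSub (L · tower L N j)`,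
`Σ_{P ∈ perWin N} nhsNormSq (curl_1 (levelQ' L N j 1 X)̃ P) ≤ (L⁴ ∕ L^d)^{j+1} · Σ_{p ∈ perWin (L · tower L N j)} nhsNormSq (curl_1 X̃ p)` — the `(j+1)`-fold linearised average at the flat
background does not increase the Maxwell energy beyond `L^{(4−d)(j+1)}` (ONE in `d = 4`), uniformly in `N`, `n`, `j`. [folklore] -/
theorem coarse_curl_energy_levelQ'_flat_le [Nonempty n] {L N : ℕ} [NeZero L] [NeZero N] :
    ∀ (j : ℕ) (X : TDir d n (L * tower L N j)), X ∈ skewSub d n (L * tower L N j) →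
      ∑ P ∈ perWin d N, nhsNormSq (curl (flatCfg : Site d → Fin d → (Matrix n n ℂ)ˣ)
          (chartDir (ContinuousLinearMap.id ℝ (Matrix n n ℂ)) N
            ((levelQ' L N j (flatCfg : Site d → Fin d → (Matrix n n ℂ)ˣ) X : ↥(skewSub d n N)) : TDir d n N)) P)
        ≤ ((L : ℝ) ^ 4 / (L : ℝ) ^ d) ^ (j + 1) * ∑ p ∈ perWin d (L * tower L N j), nhsNormSq (curl (flatCfg : Site d → Fin d → (Matrix n n ℂ)ˣ)
          (chartDir (ContinuousLinearMap.id ℝ (Matrix n n ℂ)) (L * tower L N j) X) p)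
  | 0, X, hX => by
      haveI : NeZero (L * N) := ⟨Nat.mul_ne_zero (NeZero.ne L) (NeZero.ne N)⟩
      show ∑ P ∈ perWin d N, nhsNormSq (curl (flatCfg : Site d → Fin d → (Matrix n n ℂ)ˣ)
          (chartDir (ContinuousLinearMap.id ℝ (Matrix n n ℂ)) N
            ((levelQ' L N 0 (flatCfg : Site d → Fin d → (Matrix n n ℂ)ˣ) X : ↥(skewSub d n N)) : TDir d n N)) P)
        ≤ ((L : ℝ) ^ 4 / (L : ℝ) ^ d) ^ (0 + 1) * ∑ p ∈ perWin d (L * N), nhsNormSq (curl (flatCfg : Site d → Fin d → (Matrix n n ℂ)ˣ)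
          (chartDir (ContinuousLinearMap.id ℝ (Matrix n n ℂ)) (L * N) (X : TDir d n (L * N))) p)
      rw [zero_add, pow_one, coe_levelQ'_zero_flatCfg (L := L) (N := N) (X := X) hX]
      exact coarse_curl_energy_le_sharp (L := L) (M := N) X
  | j + 1, X, hX => by
      haveI : NeZero (L * tower L N j) := ⟨Nat.mul_ne_zero (NeZero.ne L) (tower_ne_zero L N j)⟩
      haveI : NeZero (L * (L * tower L N j)) := ⟨Nat.mul_ne_zero (NeZero.ne L) (Nat.mul_ne_zero (NeZero.ne L) (tower_ne_zero L N j))⟩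
      show ∑ P ∈ perWin d N, nhsNormSq (curl (flatCfg : Site d → Fin d → (Matrix n n ℂ)ˣ)
          (chartDir (ContinuousLinearMap.id ℝ (Matrix n n ℂ)) N
            ((levelQ' L N (j + 1) (flatCfg : Site d → Fin d → (Matrix n n ℂ)ˣ) X : ↥(skewSub d n N)) : TDir d n N)) P)
        ≤ ((L : ℝ) ^ 4 / (L : ℝ) ^ d) ^ (j + 1 + 1) * ∑ p ∈ perWin d (L * (L * tower L N j)), nhsNormSq (curl (flatCfg : Site d → Fin d → (Matrix n n ℂ)ˣ)
          (chartDir (ContinuousLinearMap.id ℝ (Matrix n n ℂ)) (L * (L * tower L N j)) (X : TDir d n (L * (L * tower L N j)))) p)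
      rw [levelQ'_succ_flatCfg]
      have h1 := coarse_curl_energy_levelQ'_flat_le j _ (fderiv_coord_flatCfg_mem_skewSub hX)
      have h2 := coarse_curl_energy_le_sharp (L := L) (M := L * tower L N j) X
      have hC : 0 ≤ ((L : ℝ) ^ 4 / (L : ℝ) ^ d) ^ (j + 1) := by positivity
      refine h1.trans ?_
      rw [pow_succ _ (j + 1), mul_assoc]
      exact mul_le_mul_of_nonneg_left h2 hC

end

end Summit.QuantumFields.BalabanUV.T4Continuum.NE7CoarseCurlEnergyFlatSharp
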